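import Summits.QuantumFields.GaugeBoot.Rows.GLYZc2D3Labels
import Summits.QuantumFields.GaugeBoot.Rows.GLYZc1D3BindB2
import Summits.QuantumFields.GaugeBoot.MMRowSU2
import HarnessLib

/-!
# Gauge-boot: generic torus-binding lemma for the glyz-c2-rp-3D certificate replays (rows C32–C33, C51–C60)

Cell `pub-gaugeboot` (HOME `run/shared/lean/pub/pub-gaugeboot/`), seat lean1 (binding layer for rows C32–C33, C51–C60 = the certified
glyz-c2-rp-3D windows: label sets, class/witness tables, the reduction identity, soundness, per-β bindings).

HONEST FRAMING (page 1 of every file of this cell): certified bounds on lattice expectations at STATED coupling,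
gauge group, dimension and torus size; NOT a mass gap, NOT a continuum limit, NOT a string tension, NOT large `N`.
The venture is explicitly NOT Yang–Mills-summit-bearing (barriers `FixedCouplingUltralocality`,
`PerturbativeInvisibility`).

lean3's certificate halves state the equality rows of a problem file as sparse column rows `(rhs, [(column, coefficient), …])`;
lean2's per-β modules prove the same rows, written over label WORDS (`ERow`, `rowSum β₀ L (row j) = 0`), for the torus state.
The per-row DATA CHECK `rowOK` (right-hand side `0`, distinct in-range columns, vanishing `c1` components, and the column row read
through `GLYZc2D3.label` is a PERMUTATION of the word row) turns the latter into the former for `y β L v = ⟨W_0(label v)⟩`: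
`heq_of_rowsOK`. Each per-β binding `GLYZc2D3BindB<tag>` then needs chunked `decide`s of `rowOK` over the rows.
-/

noncomputable section

open Literature.MathematicalPhysics.QuantumFieldTheory
open Summit.QuantumFields.GaugeBoot.Certificates Summit.QuantumFields.GaugeBoot.Certificates.Sparse

namespace Summit.QuantumFields.GaugeBoot

namespace GLYZc2D3

/-- A sparse problem row read through the labels: `[(labelN v, c), …]`. -/
def rwPairs (r : List (ℕ × ℚ)) : List (Word 3 × ℚ) := r.map fun p => (labelN p.1, p.2)

/-- A word row as (word, coefficient) pairs (the `c1` components are dropped; `rowOK` checks they vanish). -/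
def ePairs (er : ERow) : List (Word 3 × ℚ) := er.map fun t => (t.1, t.2.1)

/-- **The per-row data check**: right-hand side `0`, distinct columns `< 1449`, vanishing `c1` components, and the
labelled column row is a permutation of the word row. -/
def rowOK (rw : ℚ × List (ℕ × ℚ)) (er : ERow) : Bool :=
  decide (rw.1 = 0) && decide ((rw.2.map Prod.fst).Nodup) && rw.2.all (fun p => decide (p.1 < 1449)) &&
    er.all (fun t => decide (t.2.2 = 0)) && decide ((rwPairs rw.2).Perm (ePairs er))

/-- The list sum of a word row with vanishing `c1` components is `rowSum`. -/
theorem sum_ePairs (β : ℝ) (L : ℕ) [NeZero L] :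
    ∀ er : ERow, (∀ t ∈ er, t.2.2 = 0) →
      ((ePairs er).map fun q => (q.2 : ℝ) * Rung0D3.W β L q.1).sum = rowSum β L er
  | [], _ => by simp [ePairs, rowSum]
  | t :: er, h => by
    have ht : t.2.2 = 0 := h t (by simp)
    have ih := sum_ePairs β L er fun s hs => h s (List.mem_cons_of_mem _ hs)
    simp only [ePairs, rowSum, List.map_cons, List.sum_cons] at ih ⊢
    rw [ih, ht]
    push_cast
    ring

variable (β : ℝ) (L : ℕ) [NeZero L]

/-- **From the data check to lean3's `heq`**: if every sparse row `rows e` (`e < N`) passes `rowOK` against a word row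
`erow e` that vanishes on the torus state (`rowSum β L (erow e) = 0`, lean2), then `Σ_v (rows e)_v · y β L v = rhs_e`. -/
theorem heq_of_rowsOK {N : ℕ} (rows : ℕ → ℚ × List (ℕ × ℚ)) (erow : ℕ → ERow)
    (hok : ∀ e < N, rowOK (rows e) (erow e) = true) (hE : ∀ e < N, rowSum β L (erow e) = 0) (e : Fin N) :
    ∑ v : Fin 1449, (sget (rows e.val).2 v.val : ℝ) * y β L v = ((rows e.val).1 : ℝ) := by
  have hok' := hok e.val e.isLt
  simp only [rowOK, Bool.and_eq_true, decide_eq_true_eq, List.all_eq_true] at hok'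
  obtain ⟨⟨⟨⟨hrhs, hnd⟩, hlt⟩, hc1⟩, hperm⟩ := hok'
  rw [hrhs, Rat.cast_zero]
  have hy : ∀ v : Fin 1449, y β L v = Rung0D3.W β L (labelN v.val) := fun v => rfl
  simp only [hy]
  rw [GLYZc1D3.sum_sget_mul (fun k => Rung0D3.W β L (labelN k)) _ hnd fun p hp => hlt p hp]
  have hmap : ((rows e.val).2.map fun p => (p.2 : ℝ) * Rung0D3.W β L (labelN p.1)) =
      (rwPairs (rows e.val).2).map fun q => (q.2 : ℝ) * Rung0D3.W β L q.1 := by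
    simp [rwPairs, List.map_map, Function.comp_def]
  rw [hmap, (hperm.map _).sum_eq, sum_ePairs β L (erow e.val) fun t ht => hc1 t ht]
  exact hE e.val e.isLt

end GLYZc2D3

end Summit.QuantumFields.GaugeBoot

end
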